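import Literature.Geometry.Kaehler.LelongNumberExists
import Literature.Geometry.GeometricMeasureTheory.RadialDensityLelongJensen
import HarnessLib

/-!
# Monotonicity of the mass ratio of an analytic set (Chirka §15.1 Prop. 1): discharge of `Chirka1989_massRatio_monotoneOn`

Let `A ⊆ Ω` be an analytic subset of pure dimension `p` of an open subset `Ω` of a
finite-dimensional complex inner product space `V`, `a ∈ V`. This file discharges the named fact
`Literature.Geometry.Kaehler.Chirka1989_massRatio_monotoneOn` of
`Literature/Geometry/Kaehler/HolomorphicChainFacts.lean` ([Chirka1989, §15.1 Prop. 1]: *"the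
function `r^{-2p} vol_{2p} A_r` decreases monotone as `r → 0`"*):

* `Literature.Geometry.Kaehler.Chirka1989_massRatio_monotoneOn_holds` — for `B(a, R₀) ⊆ Ω` the
  mass ratio `r ↦ 𝓗^{2p}(A ∩ B(a, r)) / r^{2p}` is monotone non-decreasing on `(0, R₀)`.

It is obtained from **Chirka's formula (∗) in exact form**
(`HolomorphicChain.measure_inter_ball_div_pow_eq_lelong_add_lelongW`): for `p = q + 1 ≥ 1`,
`𝐁(a, ρ) ⊆ Ω` and `0 < r < ρ`,

`𝓗^{2p}(A ∩ B(a, r)) / r^{2p} = Λ + W(r)`,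

where `Λ = lim_{r → 0⁺} 𝓗^{2p}(A ∩ B(a,r))/r^{2p}` is the (un-normalised) Lelong number of
`LelongNumberExists.lean` and `W(r) = ∫_{reg A ∩ B(a,r)} ‖z - a‖^{-2p}(1 - σ) d𝓗^{2p}`
(`HolomorphicChain.lelongW`) is the defect — Chirka's `vol A_r = n c(p) r^{2p} + r^{2p} ∫_{A_r} ω₀ᵖ/p!`
[Chirka1989, §15.1 (∗), p. 189]; `W` is visibly monotone in `r` (`lelongW_mono`). Formula (∗) in
turn is the Lelong–Jensen identity of `RadialDensityLelongJensen.lean`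
(`measure_lt_add_mul_setLIntegral_eq_of_profile_invariance`) applied to
`μ = 𝓗^{2p} ⌞ (reg A ∩ B(a, ρ))`, `rad = rad_a`, `σ` the tangential fraction, whose
profile-invariance hypothesis is Stokes' theorem for the radial profile weights along the
`d`-closed chain `[A]` (`ChainRadialStokes.lean`), here for profiles located left of ANY `x₀`
with `e^{x₀} < ρ` (`setIntegral_twoPow_ddcForm_radialWeight_ofSet_eq_of_exp_lt`; the version of
`LelongNumberExists.lean` fixes the margin `x₀ = log ρ - 1`). The case `p = 0` of the named fact
is the monotonicity of `r ↦ 𝓗⁰(A ∩ B(a, r))`.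

Theorems only; no new definitions, no named facts.

## References

* E. M. Chirka, *Complex Analytic Sets*, Kluwer 1989, §15.1 Prop. 1 and formula (∗), p. 189
  [Chirka1989].
* J.-P. Demailly, *Complex analytic and differential geometry*, Ch. III §5 (5.5)–(5.6).
-/

noncomputable section

open scoped Manifold Topology ENNReal InnerProductSpace ContDiff
open Set Filter MeasureTheory Metric

universe u

namespace Literature.Geometry.Kaehler

open Literature.Geometry.GeometricMeasureTheory TwoForm

variable {V : Type u} [NormedAddCommGroup V] [InnerProductSpace ℂ V]
  [FiniteDimensional ℂ V] [MeasurableSpace V] [BorelSpace V]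
  {Ω : TopologicalSpace.Opens V} {q : ℕ}

namespace HolomorphicChain

/-! ### The sets `{rad_a < r}`, `{r ≤ rad_a}` versus the balls -/

omit [InnerProductSpace ℂ V] [FiniteDimensional ℂ V] [MeasurableSpace V] [BorelSpace V] in
/-- Off the centre, `{rad_a < r}` is the ball `B(a, r)`. [folklore] -/
private theorem setOf_radA_lt_sdiff_singleton (a : V) (r : ℝ) :
    {z : V | radA a z < r} \ {a} = ball a r \ {a} := by
  ext z
  simp only [Set.mem_sdiff, mem_setOf_eq, mem_singleton_iff, mem_ball, dist_eq_norm]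
  constructor
  · rintro ⟨h1, h2⟩; exact ⟨by rwa [radA_of_ne a h2] at h1, h2⟩
  · rintro ⟨h1, h2⟩; exact ⟨by rwa [radA_of_ne a h2], h2⟩

omit [InnerProductSpace ℂ V] [FiniteDimensional ℂ V] [MeasurableSpace V] [BorelSpace V] in
/-- Off the centre, `{r ≤ rad_a}` is the complement of the ball `B(a, r)`. [folklore] -/
private theorem setOf_le_radA_sdiff_singleton (a : V) (r : ℝ) :
    {z : V | r ≤ radA a z} \ {a} = (ball a r)ᶜ \ {a} := by
  ext z
  simp only [Set.mem_sdiff, mem_setOf_eq, mem_singleton_iff, mem_compl_iff, mem_ball, dist_eq_norm,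
    not_lt]
  constructor
  · rintro ⟨h1, h2⟩; exact ⟨by rwa [radA_of_ne a h2] at h1, h2⟩
  · rintro ⟨h1, h2⟩; exact ⟨by rwa [radA_of_ne a h2], h2⟩

omit [InnerProductSpace ℂ V] [FiniteDimensional ℂ V] in
/-- `{rad_a < r}` and `B(a, r)` agree `𝓗^{2(q+1)}`-almost everywhere (they differ at most at the
centre, a null point). [folklore] -/
private theorem setOf_radA_lt_ae_eq_ball (a : V) (r : ℝ) :
    {z : V | radA a z < r} =ᵐ[(μHE[2 * (q + 1)] : Measure V)] ball a r := by
  have hnull : (μHE[2 * (q + 1)] : Measure V) {a} = 0 := euclideanHausdorffMeasure_singleton (Nat.succ_pos q) a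
  have h1 : ({z : V | radA a z < r} \ {a} : Set V) =ᵐ[(μHE[2 * (q + 1)] : Measure V)] {z : V | radA a z < r} :=
    sdiff_null_ae_eq_self hnull
  have h2 : (ball a r \ {a} : Set V) =ᵐ[(μHE[2 * (q + 1)] : Measure V)] ball a r :=
    sdiff_null_ae_eq_self hnull
  exact (h1.symm.trans (by rw [setOf_radA_lt_sdiff_singleton])).trans h2

omit [InnerProductSpace ℂ V] [FiniteDimensional ℂ V] in
/-- `{r ≤ rad_a}` and `B(a, r)ᶜ` agree `𝓗^{2(q+1)}`-almost everywhere. [folklore] -/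
private theorem setOf_le_radA_ae_eq_compl_ball (a : V) (r : ℝ) :
    {z : V | r ≤ radA a z} =ᵐ[(μHE[2 * (q + 1)] : Measure V)] (ball a r)ᶜ := by
  have hnull : (μHE[2 * (q + 1)] : Measure V) {a} = 0 := euclideanHausdorffMeasure_singleton (Nat.succ_pos q) a
  have h1 : ({z : V | r ≤ radA a z} \ {a} : Set V) =ᵐ[(μHE[2 * (q + 1)] : Measure V)] {z : V | r ≤ radA a z} :=
    sdiff_null_ae_eq_self hnull
  have h2 : ((ball a r)ᶜ \ {a} : Set V) =ᵐ[(μHE[2 * (q + 1)] : Measure V)] (ball a r)ᶜ :=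
    sdiff_null_ae_eq_self hnull
  exact (h1.symm.trans (by rw [setOf_le_radA_sdiff_singleton])).trans h2

section OfSet

variable {A : Set Ω} (hA : HasPureDim 𝓘(ℂ, V) A (q + 1))

/-! ### Stokes on balls for profiles left of an arbitrary level -/

/-- **Stokes for `[A]` on balls, arbitrary margin**: for profiles located left of `x₀` with
`e^{x₀} < ρ` and `𝐁(a, ρ) ⊆ Ω`, the Monge–Ampère integrals over `reg A ∩ B(a, ρ)` agree
(`θ_A = 1`; the tree's `setIntegral_twoPow_ddcForm_radialWeight_ofSet_eq` is the case
`x₀ = log ρ - 1`). [cite: Chirka1989, §15.1] -/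
theorem setIntegral_twoPow_ddcForm_radialWeight_ofSet_eq_of_exp_lt {h₁ h₂ : ℝ → ℝ}
    {s₁ ε₁ s₂ ε₂ x₀ : ℝ} (hh₁ : IsProfileTransition h₁ s₁ ε₁) (hh₂ : IsProfileTransition h₂ s₂ ε₂)
    (hs₁ : s₁ + ε₁ ≤ x₀) (hs₂ : s₂ + ε₂ ≤ x₀) {a : V} {ρ : ℝ} (hρ : Real.exp x₀ < ρ)
    (hΩ : closedBall a ρ ⊆ (Ω : Set V)) :
    ∫ z in (ofSet A hA).carrier ∩ ball a ρ,
        (ddcForm (radialWeight h₁ s₁ ε₁ a) z).twoPow (q + 1) ((ofSet A hA).orientationFrame z)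
        ∂(μHE[2 * (q + 1)] : Measure V) =
      ∫ z in (ofSet A hA).carrier ∩ ball a ρ,
        (ddcForm (radialWeight h₂ s₂ ε₂ a) z).twoPow (q + 1) ((ofSet A hA).orientationFrame z)
        ∂(μHE[2 * (q + 1)] : Measure V) := by
  set T := ofSet A hA with hT
  have hSm : MeasurableSet (T.carrier ∩ ball a ρ) := T.measurableSet_carrier.inter measurableSet_ball
  have hθ : ∀ (h : ℝ → ℝ) (s ε : ℝ), EqOn
      (fun z => (ddcForm (radialWeight h s ε a) z).twoPow (q + 1) (T.orientationFrame z))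
      (fun z => (T.density z : ℝ) *
        (ddcForm (radialWeight h s ε a) z).twoPow (q + 1) (T.orientationFrame z))
      (T.carrier ∩ ball a ρ) := by
    intro h s ε z hz
    simp only [hT, density_ofSet_of_mem_carrier hA hz.1, Int.cast_one, one_mul]
  have h1 := IntegrableOn.congr_fun (integrableOn_twoPow_ddcForm_ofSet hA (hh₁.contDiff_radialWeight a) hΩ)
    (hθ h₁ s₁ ε₁) hSm
  have h2 := IntegrableOn.congr_fun (integrableOn_twoPow_ddcForm_ofSet hA (hh₂.contDiff_radialWeight a) hΩ)
    (hθ h₂ s₂ ε₂) hSm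
  have hst := T.setIntegral_twoPow_ddcForm_radialWeight_eq hh₁ hh₂ hs₁ hs₂ hρ
    (ball_subset_closedBall.trans hΩ) h1 h2
  rw [setIntegral_congr_fun hSm (hθ h₁ s₁ ε₁), setIntegral_congr_fun hSm (hθ h₂ s₂ ε₂)]
  exact hst

/-- **The profile-invariance hypothesis for `[A]` on `B(a, ρ)`**, for every level `x₀` with
`e^{x₀} < ρ`: the profile functionals of `μ = 𝓗^{2(q+1)} ⌞ (reg A ∩ B(a, ρ))` (radius `rad_a`,
tangential fraction `σ`) all equal `L(ρ, h) = ((q+1)! 2^{q+1})⁻¹ ∫ (dd^c w_h)^{q+1}(ξ_A)` for any fixed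
profile `h` located left of `x₀`. [cite: Chirka1989, §15.1] -/
theorem profile_invariance_ofSet {a : V} {ρ x₀ : ℝ} (hρ : Real.exp x₀ < ρ)
    (hΩ : closedBall a ρ ⊆ (Ω : Set V)) {h : ℝ → ℝ} {s ε : ℝ} (hh : IsProfileTransition h s ε)
    (hs : s + ε ≤ x₀) :
    ∀ (h' : ℝ → ℝ) (s' ε' : ℝ), 0 < ε' → s' + ε' ≤ x₀ → IsProfileTransition h' s' ε' →
      ∫⁻ z, ENNReal.ofReal ((radA a z ^ (2 * (q + 1)))⁻¹ *
        (h' (Real.log (radA a z)) ^ (q + 1) * (1 - (ofSet A hA).tangentialFraction a z) +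
          profileKernel h' (q + 1) (Real.log (radA a z)) * (ofSet A hA).tangentialFraction a z))
        ∂((μHE[2 * (q + 1)] : Measure V).restrict ((ofSet A hA).carrier ∩ ball a ρ)) =
      ENNReal.ofReal ((((q + 1).factorial : ℝ) * 2 ^ (q + 1))⁻¹ *
        ∫ z in (ofSet A hA).carrier ∩ ball a ρ,
          (ddcForm (radialWeight h s ε a) z).twoPow (q + 1) ((ofSet A hA).orientationFrame z)
          ∂(μHE[2 * (q + 1)] : Measure V)) := by
  intro h' s' ε' _ hs' hh'
  rw [lintegral_profileIntegrand_ofSet_eq hA hh' hΩ,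
    setIntegral_twoPow_ddcForm_radialWeight_ofSet_eq_of_exp_lt hA hh' hh hs' hs hρ hΩ]

/-! ### Chirka's formula (∗), exactly -/

/-- **The Lelong–Jensen identity for an analytic set** (Chirka's formula (∗) before normalisation):
for `𝐁(a, ρ) ⊆ Ω`, a level `x₀` with `e^{x₀} < ρ`, a profile `h` located left of `x₀`, and
`0 < r ≤ e^{x₀}`,
`𝓗^{2(q+1)}(A ∩ B(a,r)) + r^{2(q+1)} ∫_{reg A ∩ B(a,ρ) ∖ B(a,r)} ‖z-a‖^{-2(q+1)}(1-σ) d𝓗 = r^{2(q+1)} L(ρ, h)`.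
[cite: Chirka1989, §15.1 (∗)] -/
theorem measure_inter_ball_add_eq_of_exp_lt {a : V} {ρ x₀ : ℝ} (hρ : Real.exp x₀ < ρ)
    (hΩ : closedBall a ρ ⊆ (Ω : Set V)) {h : ℝ → ℝ} {s ε : ℝ} (hh : IsProfileTransition h s ε)
    (hs : s + ε ≤ x₀) {r : ℝ} (hr : 0 < r) (hrx : Real.log r ≤ x₀) :
    (μHE[2 * (q + 1)] : Measure V) (((↑) : Ω → V) '' A ∩ ball a r) +
        ENNReal.ofReal (r ^ (2 * (q + 1))) *
          ∫⁻ z in (ofSet A hA).carrier ∩ ball a ρ ∩ (ball a r)ᶜ,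
            ENNReal.ofReal ((radA a z ^ (2 * (q + 1)))⁻¹ * (1 - (ofSet A hA).tangentialFraction a z))
            ∂(μHE[2 * (q + 1)] : Measure V) =
      ENNReal.ofReal (r ^ (2 * (q + 1))) *
        ENNReal.ofReal ((((q + 1).factorial : ℝ) * 2 ^ (q + 1))⁻¹ *
          ∫ z in (ofSet A hA).carrier ∩ ball a ρ,
            (ddcForm (radialWeight h s ε a) z).twoPow (q + 1) ((ofSet A hA).orientationFrame z)
            ∂(μHE[2 * (q + 1)] : Measure V)) := by
  set T := ofSet A hA with hT
  set S := T.carrier ∩ ball a ρ with hS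
  have hSm : MeasurableSet S := T.measurableSet_carrier.inter measurableSet_ball
  set μ : Measure V := (μHE[2 * (q + 1)] : Measure V).restrict S with hμ
  have hμS : (μHE[2 * (q + 1)] : Measure V) S < ⊤ :=
    (measure_mono (inter_subset_inter_right _ ball_subset_closedBall)).trans_lt
      (measure_carrier_ofSet_inter_closedBall_lt_top hA hΩ)
  haveI : IsFiniteMeasure μ := ⟨by rw [hμ, Measure.restrict_apply_univ]; exact hμS⟩
  have hrρ : r < ρ := by
    have : r ≤ Real.exp x₀ := by rw [← Real.exp_log hr]; exact Real.exp_le_exp.2 hrx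
    exact this.trans_lt hρ
  have H := profile_invariance_ofSet hA hρ hΩ hh hs
  have hmain := measure_lt_add_mul_setLIntegral_eq_of_profile_invariance (μ := μ) (x₀ := x₀)
    (measurable_radA a) (radA_pos a) (T.measurable_tangentialFraction a) (T.tangentialFraction_nonneg a)
    (T.tangentialFraction_le_one a) le_add_self H hr hrx
  -- `μ {rad_a < r} = 𝓗(A ∩ B(a, r))`
  have h1 : μ {z | radA a z < r} = (μHE[2 * (q + 1)] : Measure V) (((↑) : Ω → V) '' A ∩ ball a r) := by
    rw [hμ, Measure.restrict_apply' hSm,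
      measure_congr ((setOf_radA_lt_ae_eq_ball (q := q) a r).inter (ae_eq_refl S)),
      measure_image_inter_eq_carrier_inter hA (ball a r), ← hT]
    congr 1
    ext z
    simp only [hS, mem_inter_iff, mem_ball]
    constructor
    · rintro ⟨h1, h2, _⟩; exact ⟨h2, h1⟩
    · rintro ⟨h1, h2⟩; exact ⟨h2, h1, lt_trans h2 hrρ⟩
  -- the tail integral
  have hset : ((ball a r)ᶜ ∩ S : Set V) = S ∩ (ball a r)ᶜ := Set.inter_comm _ _
  have hae : ({z : V | r ≤ radA a z} ∩ S : Set V) =ᵐ[(μHE[2 * (q + 1)] : Measure V)] (S ∩ (ball a r)ᶜ : Set V) := by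
    rw [← hset]
    exact (setOf_le_radA_ae_eq_compl_ball (q := q) a r).inter (ae_eq_refl S)
  rw [h1] at hmain
  convert hmain using 3
  rw [hμ, Measure.restrict_restrict' hSm]
  exact (setLIntegral_congr hae).symm

/-- **Chirka's formula (∗), exactly**: for `A ⊆ Ω` of pure dimension `q + 1`, `𝐁(a, ρ) ⊆ Ω`,
`Λ` the limit of the mass ratios at `a` (the un-normalised Lelong number; it exists by
`exists_tendsto_measure_inter_ball_div_pow`), and every `0 < r < ρ`:
`𝓗^{2(q+1)}(A ∩ B(a, r)) / r^{2(q+1)} = Λ + W(r)` with the defect `W = lelongW`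
("`vol A_r = n(A,a) c(p) r^{2p} + r^{2p} ∫_{A_r} ω₀ᵖ/p!`"). [cite: Chirka1989, §15.1 (∗), p. 189] -/
theorem measure_inter_ball_div_pow_eq_lelong_add_lelongW {a : V} {ρ : ℝ}
    (hΩ : closedBall a ρ ⊆ (Ω : Set V)) {Λ : ℝ≥0∞}
    (hΛ : Tendsto (fun r : ℝ => (μHE[2 * (q + 1)] : Measure V) (((↑) : Ω → V) '' A ∩ ball a r) /
        ENNReal.ofReal (r ^ (2 * (q + 1)))) (𝓝[>] 0) (𝓝 Λ))
    {r : ℝ} (hr : r ∈ Ioo 0 ρ) :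
    (μHE[2 * (q + 1)] : Measure V) (((↑) : Ω → V) '' A ∩ ball a r) / ENNReal.ofReal (r ^ (2 * (q + 1))) =
      Λ + (ofSet A hA).lelongW a r := by
  set T := ofSet A hA with hT
  set S := T.carrier ∩ ball a ρ with hS
  have hSm : MeasurableSet S := T.measurableSet_carrier.inter measurableSet_ball
  set μ : Measure V := (μHE[2 * (q + 1)] : Measure V).restrict S with hμ
  have hμS : (μHE[2 * (q + 1)] : Measure V) S < ⊤ :=
    (measure_mono (inter_subset_inter_right _ ball_subset_closedBall)).trans_lt
      (measure_carrier_ofSet_inter_closedBall_lt_top hA hΩ)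
  haveI : IsFiniteMeasure μ := ⟨by rw [hμ, Measure.restrict_apply_univ]; exact hμS⟩
  set f : V → ℝ≥0∞ := fun z => ENNReal.ofReal ((radA a z ^ (2 * (q + 1)))⁻¹ *
    (1 - T.tangentialFraction a z)) with hf
  -- the level `x₀ = log r` and a profile located left of it
  set x₀ := Real.log r with hx₀
  have hρ : Real.exp x₀ < ρ := by rw [hx₀, Real.exp_log hr.1]; exact hr.2
  obtain ⟨h, hh⟩ := exists_isProfileTransition (x₀ - 2) one_pos
  have hs : x₀ - 2 + 1 ≤ x₀ := by linarith
  set L : ℝ≥0∞ := ENNReal.ofReal ((((q + 1).factorial : ℝ) * 2 ^ (q + 1))⁻¹ *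
    ∫ z in S, (ddcForm (radialWeight h (x₀ - 2) 1 a) z).twoPow (q + 1) (T.orientationFrame z)
      ∂(μHE[2 * (q + 1)] : Measure V)) with hL
  have H := profile_invariance_ofSet hA hρ hΩ hh hs
  -- the identity at `r`
  have hid := measure_inter_ball_add_eq_of_exp_lt hA hρ hΩ hh hs hr.1 le_rfl
  rw [← hT, ← hS, ← hL] at hid
  -- the limit: `Λ = L - W(ρ)`
  have hlim := tendsto_measure_div_pow_of_profile_invariance (μ := μ) (x₀ := x₀) (measurable_radA a)
    (radA_pos a) (T.measurable_tangentialFraction a) (T.tangentialFraction_nonneg a)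
    (T.tangentialFraction_le_one a) le_add_self ENNReal.ofReal_ne_top H
  have hlim' : Tendsto (fun r : ℝ => (μHE[2 * (q + 1)] : Measure V) (((↑) : Ω → V) '' A ∩ ball a r) /
      ENNReal.ofReal (r ^ (2 * (q + 1)))) (𝓝[>] 0) (𝓝 (L - ∫⁻ z, f z ∂μ)) := by
    refine hlim.congr' ?_
    filter_upwards [Ioo_mem_nhdsGT hr.1] with r' hr'
    congr 1
    rw [hμ, Measure.restrict_apply' hSm,
      measure_congr ((setOf_radA_lt_ae_eq_ball (q := q) a r').inter (ae_eq_refl S)),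
      measure_image_inter_eq_carrier_inter hA (ball a r'), ← hT]
    congr 1
    ext z
    simp only [hS, mem_inter_iff, mem_ball]
    constructor
    · rintro ⟨h1, h2, _⟩; exact ⟨h2, h1⟩
    · rintro ⟨h1, h2⟩; exact ⟨h2, h1, lt_trans h2 (hr'.2.trans hr.2)⟩
  have hΛeq : Λ = L - ∫⁻ z, f z ∂μ := tendsto_nhds_unique hΛ hlim'
  -- `W(ρ) = W(r) + tail`, `W(ρ) ≤ L`
  have hWρ : ∫⁻ z, f z ∂μ = T.lelongW a ρ := by rw [hμ]; rfl
  have hWle : ∫⁻ z, f z ∂μ ≤ L :=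
    lintegral_inv_pow_mul_one_sub_le (μ := μ) (measurable_radA a) (radA_pos a)
      (T.measurable_tangentialFraction a) (T.tangentialFraction_nonneg a) (T.tangentialFraction_le_one a) H
  have hsplit : T.lelongW a r + ∫⁻ z in S ∩ (ball a r)ᶜ, f z ∂(μHE[2 * (q + 1)] : Measure V) =
      ∫⁻ z, f z ∂μ := by
    have := lintegral_add_compl (μ := μ) f (measurableSet_ball (x := a) (ε := r))
    rw [hμ, Measure.restrict_restrict measurableSet_ball, Measure.restrict_restrict measurableSet_ball.compl,
      show ball a r ∩ S = T.carrier ∩ ball a r from by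
        rw [hS, inter_comm, inter_assoc, inter_eq_right.2 (ball_subset_ball hr.2.le)],
      Set.inter_comm (ball a r)ᶜ S] at this
    rw [hμ]
    exact this
  have hLt : L ≠ ⊤ := ENNReal.ofReal_ne_top
  have hWρt : ∫⁻ z, f z ∂μ ≠ ⊤ := ne_top_of_le_ne_top hLt hWle
  have hWrle : T.lelongW a r ≤ ∫⁻ z, f z ∂μ := by rw [← hsplit]; exact le_self_add
  have htail : ∫⁻ z in S ∩ (ball a r)ᶜ, f z ∂(μHE[2 * (q + 1)] : Measure V) =
      ∫⁻ z, f z ∂μ - T.lelongW a r :=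
    ENNReal.eq_sub_of_add_eq' hWρt (by rw [add_comm]; exact hsplit)
  -- assemble
  have hb0 : ENNReal.ofReal (r ^ (2 * (q + 1))) ≠ 0 := (ENNReal.ofReal_pos.2 (pow_pos hr.1 _)).ne'
  have hbt : ENNReal.ofReal (r ^ (2 * (q + 1))) ≠ ⊤ := ENNReal.ofReal_ne_top
  have htail_le : ∫⁻ z in S ∩ (ball a r)ᶜ, f z ∂(μHE[2 * (q + 1)] : Measure V) ≤ L := by
    rw [htail]; exact tsub_le_self.trans hWle
  have hAt : ENNReal.ofReal (r ^ (2 * (q + 1))) *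
      ∫⁻ z in S ∩ (ball a r)ᶜ, f z ∂(μHE[2 * (q + 1)] : Measure V) ≠ ⊤ :=
    ENNReal.mul_ne_top hbt (ne_top_of_le_ne_top hLt htail_le)
  have heq : (μHE[2 * (q + 1)] : Measure V) (((↑) : Ω → V) '' A ∩ ball a r) =
      ENNReal.ofReal (r ^ (2 * (q + 1))) *
        (L - ∫⁻ z in S ∩ (ball a r)ᶜ, f z ∂(μHE[2 * (q + 1)] : Measure V)) := by
    rw [ENNReal.mul_sub (fun _ _ => hbt)]
    exact ENNReal.eq_sub_of_add_eq hAt hid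
  rw [heq, mul_comm, ENNReal.mul_div_cancel_right hb0 hbt, htail, hΛeq,
    (ENNReal.cancel_of_ne (ENNReal.sub_ne_top hWρt)).tsub_tsub_assoc hWle hWrle]

include hA in
/-- **Monotonicity on `(0, ρ)`**: for `𝐁(a, ρ) ⊆ Ω` the mass ratio
`r ↦ 𝓗^{2(q+1)}(A ∩ B(a, r)) / r^{2(q+1)}` is monotone non-decreasing on `(0, ρ)`.
[cite: Chirka1989, §15.1 Prop. 1, p. 189] -/
theorem monotoneOn_measure_inter_ball_div_pow {a : V} {ρ : ℝ} (hρ : 0 < ρ)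
    (hΩ : closedBall a ρ ⊆ (Ω : Set V)) :
    MonotoneOn (fun r : ℝ => (μHE[2 * (q + 1)] : Measure V) (((↑) : Ω → V) '' A ∩ ball a r) /
      ENNReal.ofReal (r ^ (2 * (q + 1)))) (Ioo 0 ρ) := by
  obtain ⟨Λ, -, hΛ⟩ := exists_tendsto_measure_inter_ball_div_pow hA hρ hΩ
  intro r₁ hr₁ r₂ hr₂ h12
  simp only
  rw [measure_inter_ball_div_pow_eq_lelong_add_lelongW hA hΩ hΛ hr₁,
    measure_inter_ball_div_pow_eq_lelong_add_lelongW hA hΩ hΛ hr₂]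
  exact add_le_add_right (lelongW_mono _ a h12) Λ

include hA in
/-- **The Lelong number is the infimum of the mass ratios**: `Λ ≤ 𝓗^{2(q+1)}(A ∩ B(a, r))/r^{2(q+1)}`
for every `0 < r < ρ`, `𝐁(a, ρ) ⊆ Ω`. [cite: Chirka1989, §15.1 Prop. 1, p. 189] -/
theorem lelong_le_measure_inter_ball_div_pow {a : V} {ρ : ℝ} (hΩ : closedBall a ρ ⊆ (Ω : Set V))
    {Λ : ℝ≥0∞}
    (hΛ : Tendsto (fun r : ℝ => (μHE[2 * (q + 1)] : Measure V) (((↑) : Ω → V) '' A ∩ ball a r) /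
        ENNReal.ofReal (r ^ (2 * (q + 1)))) (𝓝[>] 0) (𝓝 Λ))
    {r : ℝ} (hr : r ∈ Ioo 0 ρ) :
    Λ ≤ (μHE[2 * (q + 1)] : Measure V) (((↑) : Ω → V) '' A ∩ ball a r) / ENNReal.ofReal (r ^ (2 * (q + 1))) := by
  rw [measure_inter_ball_div_pow_eq_lelong_add_lelongW hA hΩ hΛ hr]
  exact le_self_add

end OfSet

end HolomorphicChain

/-! ### Discharge of the named fact -/

/-- **Chirka §15.1 Prop. 1** — discharge of `Chirka1989_massRatio_monotoneOn`: for an analytic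
subset `A ⊆ Ω` of pure dimension `p` and `B(a, R₀) ⊆ Ω`, the mass ratio
`r ↦ 𝓗^{2p}(A ∩ B(a, r)) / r^{2p}` is monotone non-decreasing on `(0, R₀)` (*"the function
`r^{-2p} vol_{2p} A_r` decreases monotone as `r → 0`"*). For `p ≥ 1` by Chirka's formula (∗)
(`HolomorphicChain.measure_inter_ball_div_pow_eq_lelong_add_lelongW`) on the balls `𝐁(a, ρ)`,
`r₂ < ρ < R₀`; for `p = 0` it is the monotonicity of `r ↦ 𝓗⁰(A ∩ B(a, r))`.
[cite: Chirka1989, §15.1 Prop. 1, p. 189] -/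
theorem Chirka1989_massRatio_monotoneOn_holds : Chirka1989_massRatio_monotoneOn.{u} := by
  intro V _ _ _ _ _ Ω p A hA a R₀ hR₀
  cases p with
  | zero =>
    intro r₁ _ r₂ _ h12
    simp only [mul_zero, pow_zero, ENNReal.ofReal_one, div_one]
    exact measure_mono (inter_subset_inter_right _ (ball_subset_ball h12))
  | succ q =>
    intro r₁ hr₁ r₂ hr₂ h12
    -- a closed ball strictly between `r₂` and `R₀`
    set ρ := (r₂ + R₀) / 2 with hρ
    have hρr : r₂ < ρ := by rw [hρ]; linarith [hr₂.2]
    have hρR : ρ < R₀ := by rw [hρ]; linarith [hr₂.2]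
    have hρ0 : 0 < ρ := hr₂.1.trans hρr
    have hΩ : closedBall a ρ ⊆ (Ω : Set V) := (closedBall_subset_ball hρR).trans hR₀
    exact HolomorphicChain.monotoneOn_measure_inter_ball_div_pow hA hρ0 hΩ ⟨hr₁.1, lt_of_le_of_lt h12 hρr⟩
      ⟨hr₂.1, hρr⟩ h12

end Literature.Geometry.Kaehler

end
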